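import Summits.QuantumFields.BalabanUV.Beta.GAN24.DerivativeRateTransferAnalytic
import Summits.QuantumFields.BalabanUV.Beta.GAN24.MonotoneCoarsen

/-!
# `BalabanUV.Beta.GAN24.DerivativeRateTransferLoewner` — binder row G-an2-4 ∕ (CONV-C), route R6 «VALUES, NOT DERIVATIVES», PART 15:
# THE LOEWNER SOURCE OF S1 — a MONOTONE tower of effective forms whose DIAGONAL moves at rate `c·θ^k` moves EVERYWHERE at rate `c·θ^k`
# (entries), hence (PART 7) its derivative rows at the base point inherit the rate; and the diagonal rate is ONE SCALAR PER UNIT SOURCE: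
# the prolongation-consistency defect of the unit-source minimiser — no fibres, no translation invariance, any background
# (unit b2b-balaban-gan24-p3, gen 36; v1)

NOT IN PRINT; OUR PROOF (for the ROUTE; [folklore] finite-dimensional linear algebra — road P4's Loewner letters BY NAME
(`MonotoneLoewner.norm_apply_sq_le`, `MonotoneCoarsen.form_sub_effForm_conj` ∕ `effForm_chain_step_of_stab`, p3's `minimiser_energy` ∕
`constraint_mul_minimiser`) joined to PART 7's analytic transfer `DerivativeRateTransferAnalytic.deriv_step_rateω`).  HONEST FRAMING (cell contract,
verbatim): «discharging `BetaPertH` makes Bałaban's UV stability UNCONDITIONAL — a real constructive-QFT result; it is NOT the continuum limit and NOT the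
Clay problem.»  HONEST DEPENDENCY (verbatim): «continuum YM on T⁴ ⇐ BetaPertH ∧ nine spine estimates (0/9 proved); BetaPertH ⇐ (D1) ∧ (D4) ∧ CAP+tail;
G-an2-4 gates asym, D1 and NE2/3/4.»

WHY THIS FILE.  After PARTs 7–14 route R6's debt toward the u-derivative sector of (CONV-C) is «S1 + S2(ii) + (H2)» (ROUTES-GAN24 v32 «R6 — v32 NOTE»;
PRICING-GAN24 v3.30 C-R6°): S1 = the VALUE-level one-step rate of the constituents WITH BACKGROUND, on a REAL segment of backgrounds `s ∈ [0, s₁]`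
(PART 7 moved the complex neighbourhood into S2 = holomorphy + ONE bound).  Every value-rate engine in the tree at `U = 1` is a FIBRE ∕ STRIP engine
(road P1 `FibreStrip`∕`FibreRate`, NE2's (1.63)∕(1.66) strip rates, King's operator law) and uses translation invariance, which a background destroys
(X-A8 ∕ X-C1 of `YM-SURGE-PLAN.md`, not seated: «R6 U ≠ 1 one-step rate … the ONE place a new GAN24 seat pays»).  Road P4 (`MonotoneCoarsen`,
`MonotoneLoewner`) owns the one positivity structure of the cell that survives a background: the Gaussian VARIATIONAL principle — (STAB) «one averaging
step does not increase the energy» ⟹ the composite effective forms INCREASE in Loewner order (`effForm_chain_step_of_stab`) — a hypothesis SHAPE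
with no Fourier variable in it, hence typable at `U ≠ 1` (whether Bałaban's covariant averagings satisfy it with a background — the (1.67)-lower ∕
Federbush stability with unitary transporters — is NOT examined here).  THIS FILE records the two-line consequence that makes S1 EXECUTABLE for the
SYMMETRIC constituents (effective forms — the `CᵀΔ^{(k)}C`-type rows of an1's Table T; the u-derivatives of such rows are PART 12's `dEffForm` rows): for a
Loewner-monotone step `0 ≤ E_{k+1} − E_k`, ALL entries are bounded by the DIAGONAL ones (`|D_{ab}|² ≤ D_{aa}·D_{bb}`), and each diagonal one-step
increment is bounded by ONE trial field — so S1 on the segment ⇐ (STAB) along the segment + the scalar estimates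
(CONS_{k,y}) `re ⟨m_{k,y}, (P_kᴴ H_{k+1} P_k − H_k) m_{k,y}⟩ ≤ c·θ^k` (the prolongation-consistency defect of the level-`k` unit-source minimiser
`m_{k,y} = ℋ_k e_y` under ANY averaging-compatible prolongation `P_k`, `Q_{k+1} P_k = Q_k`) — a Galerkin ∕ Céa statement (the multigrid «approximation
property» on minimisers; at `U = 1` it is the computation ROUTES-GAN24 §2 R1 S2–S5 describes with a centred prolongation; with a background the same
computation with covariant differences — neither is done here).  Lens 1's (c1) of ROUTES v24 («PSD domination … NO TEETH on the non-symmetric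
constituents») is agreed: the minimiser LEGS are R7 (ρ3)'s (`GalerkinPythagoras` p259846); this file serves the effective-form rows only; the dead
«positivity ∕ domination road» (e♯)∕(e♯′) (Kato ∕ M-matrix, site basis) is a DIFFERENT positivity.  VOCABULARY: `effForm ∕ minimiser` are p3's
`PropagatorWoodburyFibre` letters (`Δ_eff(H,Q) = (QH⁻¹Qᴴ)⁻¹`, road P4's currency); their identification with the `kkt`-blocks `CompositionSingular.effForm`
of PARTs 12–14 at real nonsingular data (`CompositionSingular.effForm_eq_blockProp_inv`) enters §4 only through the hypothesis `hFeff`.  U = 1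
PRECEDENT (road P4, by name): `MonotoneTorusRate.re_diag_sub_le` ∕ `MonotoneTorusCovRate.norm_apply_le_of_le_smul_one` read P4's OPERATOR Loewner
rate `0 ≤ E_{k+1} − E_k ≤ ε_k·(curlᴴcurl)` entrywise on the torus at `θ = Lc⁻²`; here the tower is abstract, the datum is the DIAGONAL, and its source is (CONS).

WHAT THIS FILE PROVES (0 sorry, 0 `def`, nothing cited):
* §1 `norm_apply_le_of_diag_le` — `D` PSD over `ℂ`, `re D_{aa} ≤ δ` for all `a` ⟹ `‖D_{ab}‖ ≤ δ` for all `a, b` (and the robust form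
  `norm_apply_le_of_diag_le_add`: PSD only up to a slack `S` with entries `≤ σ` ⟹ `‖D_{ab}‖ ≤ δ + σ`); the tower forms
  `norm_step_apply_le_of_diag` (increasing towers) ∕ `norm_step_apply_le_of_diag'` (decreasing towers: covariances): PSD steps + diagonal rate
  `c·θ^k` ⟹ entry rate `c·θ^k`, SAME constant, SAME exponent (no `√θ`, no `δ∕2`).
* §2 THE JOIN WITH PART 7: `F k : ℂ → Matrix n n ℂ` with entries holomorphic and bounded by `B` on `ball 0 ρ`, Loewner-monotone steps with
  diagonal rate `c·θ^k` at every real `s ∈ [0, s₁]` (`s₁·cosh 1 < ρ`) ⟹ **`deriv_entry_step_rateω`**: every derivative row at the base point obeys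
  `‖∂_z(F_{k+1})_{ab}(0) − ∂_z(F_k)_{ab}(0)‖ ≤ 25·(2B)^r∕(s₁r²)·c^{1−r}·(θ^{1−r})^k` for every `r ∈ ]0,1]`, and **`exists_deriv_entry_geometricRate`**
  (one `(c′, θ′ < 1)` for all entries and all `k`).
* §2 (cont.) `deriv₂_entry_step_rateω` — the second-order rows (PART 7 `deriv₂_step_rateω`, exponent `(θ^{1−r})^{1−r}`).
* §3 THE GALERKIN SOURCE in p3's letters (`PropagatorWoodburyFibre.effForm ∕ minimiser`, `ℂ`, `ComplexOrder`): `re_effForm_apply_le_trial`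
  (`re (Δ_eff(H,Q))_{yy} ≤ re ⟨u, Hu⟩` for EVERY `u` with `Qu = e_y`), `re_effForm_apply_eq_minimiser` (equality at `u = ℋe_y`, B5 (1.65) in matrix
  form — locator only), `re_effForm_step_diag_le_cons` (the prolongated minimiser `P·ℋ_k e_y` is admissible at level `k+1` when `Q_{k+1}P = Q_k`, and
  its energy excess over `(Δ_eff^{(k)})_{yy}` IS the consistency defect), and **`effForm_entry_step_rate_of_stab_of_cons`** ∕ `…_of_trial`: (STAB_k) ∀ k +
  (CONS_{k,y}) ∀ k y ⟹ `‖(Δ_eff^{(k+1)})_{ab} − (Δ_eff^{(k)})_{ab}‖ ≤ c·θ^k` ∀ k a b — the with-background S1 shape for effective forms, reduced to two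
  families of quadratic-form inequalities about `(H_k, Q_k^f, P_k)`.
* §4 THE END OF THIS PART: `loewner_data_of_stab_of_cons` + **`deriv_effForm_entry_step_rateω`** ∕ **`exists_deriv_effForm_entry_geometricRate`** —
  a one-parameter family of towers over the real background segment `[0, s₁]` (forms, averagings AND prolongations may all depend on the background)
  with (STAB) and (CONS) uniform in `s`, and S2 for the matrix family `F` agreeing with the composite effective forms on the segment ⟹ the u-derivative
  rows `∂_z(F k)_{ab}(0)` have a geometric one-step rate (`θ^{1−r}`, every `r ∈ ]0,1]`; one `(c′, θ′ < 1)` for all entries).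
WHAT IT DOES NOT DO: discharge (STAB) or (CONS) for any of Bałaban's operators; assert which (H, Q)-tower is B12's (S2(ii)); touch the minimiser
legs ∕ fine × fine rows (R7 (ρ3), V40); supply holomorphy (S2).  SUPPLIER work on route R6 (rank 2, REDUCTION, no seat; X-A8 ∕ X-C1 not minted); no
consumer of record; NEVER «G-an2-4 closed»; NOT (CONV-C), NOT D1, NOT `BetaPertH`, NOT continuum, NOT Clay.  Records: `HOME/b2b-balaban-gan24-p3/
WOODBURY-FIBRE.md` v13.6 + `gen36/R6-LOEWNER-NOTE.md`, `HOME/beta/ROUTES-GAN24.md` v34 §2 R6, `HOME/b2b-balaban-gan24-refuter/PRICING-GAN24.md` v3.30 C-R6°.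
-/

noncomputable section

open Set Metric Matrix

namespace Summit.QuantumFields.BalabanUV.Beta.GAN24.DerivativeRateTransferLoewner

open scoped ComplexOrder
open Summit.QuantumFields.BalabanUV.Beta.GAN24.MonotoneLoewner (norm_apply_sq_le re_diag_nonneg)
open Summit.QuantumFields.BalabanUV.Beta.GAN24.DerivativeRateTransferAnalytic (rho_pos deriv_step_rateω deriv₂_step_rateω)
open Summit.QuantumFields.BalabanUV.Beta.PropagatorWoodburyFibre
open Summit.QuantumFields.BalabanUV.Beta.GAN24.MonotoneCoarsen (form_sub_effForm_conj effForm_chain_step_of_stab)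

/-! ## §1 A positive semidefinite matrix with small DIAGONAL has small ENTRIES; tower forms -/

section PSD

variable {n : Type*} {D : Matrix n n ℂ}

/-- **SMALL DIAGONAL ⟹ SMALL ENTRIES FOR A PSD MATRIX**: `D` PSD, `re D_{aa} ≤ δ` for every `a` ⟹ `‖D_{ab}‖ ≤ δ` for all `a, b`
(`|D_{ab}|² ≤ D_{aa}D_{bb} ≤ δ²`, road P4's `MonotoneLoewner.norm_apply_sq_le`). [folklore] -/
theorem norm_apply_le_of_diag_le (hD : D.PosSemidef) {δ : ℝ} (hdiag : ∀ a, (D a a).re ≤ δ) (a b : n) : ‖D a b‖ ≤ δ := by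
  have ha := re_diag_nonneg hD a; have hb := re_diag_nonneg hD b
  have h2 : ‖D a b‖ ^ 2 ≤ δ ^ 2 := (norm_apply_sq_le hD a b).trans (by nlinarith [hdiag a, hdiag b])
  exact (pow_le_pow_iff_left₀ (norm_nonneg _) (ha.trans (hdiag a)) two_ne_zero).mp h2

/-- **ROBUST FORM (monotone up to a slack)**: if only `D + S` is PSD (e.g. `S = ε·E′` when the averaging is energy-stable up to a factor `1 + ε`),
with `re (D + S)_{aa} ≤ δ` and `‖S_{ab}‖ ≤ σ`, then `‖D_{ab}‖ ≤ δ + σ` — an `O(θ^k)` slack in (STAB) costs nothing in the exponent. [folklore] -/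
theorem norm_apply_le_of_diag_le_add {S : Matrix n n ℂ} (hDS : (D + S).PosSemidef) {δ σ : ℝ} (hdiag : ∀ a, ((D + S) a a).re ≤ δ)
    (hS : ∀ a b, ‖S a b‖ ≤ σ) (a b : n) : ‖D a b‖ ≤ δ + σ := by
  have h := norm_apply_le_of_diag_le hDS hdiag a b
  rw [Matrix.add_apply] at h
  calc ‖D a b‖ = ‖(D a b + S a b) - S a b‖ := by rw [add_sub_cancel_right]
    _ ≤ ‖D a b + S a b‖ + ‖S a b‖ := norm_sub_le _ _
    _ ≤ δ + σ := add_le_add h (hS a b)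

variable {P : ℕ → Matrix n n ℂ} {c θ : ℝ}

/-- **INCREASING TOWER: PSD STEPS + DIAGONAL RATE ⟹ ENTRY RATE, SAME CONSTANT, SAME EXPONENT**: `0 ≤ P_{k+1} − P_k` (Loewner) and
`re (P_{k+1} − P_k)_{aa} ≤ c·θ^k` for all `k ≥ k₀`, `a` ⟹ `‖(P_{k+1})_{ab} − (P_k)_{ab}‖ ≤ c·θ^k` for all `k ≥ k₀`, `a`, `b`. [folklore] -/
theorem norm_step_apply_le_of_diag {k₀ : ℕ} (hstep : ∀ k, k₀ ≤ k → (P (k + 1) - P k).PosSemidef)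
    (hdiag : ∀ k, k₀ ≤ k → ∀ a, ((P (k + 1) - P k) a a).re ≤ c * θ ^ k) :
    ∀ k, k₀ ≤ k → ∀ a b, ‖P (k + 1) a b - P k a b‖ ≤ c * θ ^ k := fun k hk a b => by
  simpa only [Matrix.sub_apply] using norm_apply_le_of_diag_le (hstep k hk) (hdiag k hk) a b

/-- **DECREASING TOWER** (covariances): `0 ≤ P_k − P_{k+1}` and `re (P_k − P_{k+1})_{aa} ≤ c·θ^k` ⟹ `‖(P_{k+1})_{ab} − (P_k)_{ab}‖ ≤ c·θ^k`. [folklore] -/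
theorem norm_step_apply_le_of_diag' {k₀ : ℕ} (hstep : ∀ k, k₀ ≤ k → (P k - P (k + 1)).PosSemidef)
    (hdiag : ∀ k, k₀ ≤ k → ∀ a, ((P k - P (k + 1)) a a).re ≤ c * θ ^ k) :
    ∀ k, k₀ ≤ k → ∀ a b, ‖P (k + 1) a b - P k a b‖ ≤ c * θ ^ k := fun k hk a b => by
  rw [← norm_neg, neg_sub]
  simpa only [Matrix.sub_apply] using norm_apply_le_of_diag_le (hstep k hk) (hdiag k hk) a b

end PSD

/-! ## §2 The join with PART 7: Loewner-monotone steps with a diagonal rate on the real segment ⟹ derivative entry rows at the base point -/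

section Join

variable {n : Type*} {F : ℕ → ℂ → Matrix n n ℂ} {ρ s₁ B c θ : ℝ}

/-- the entry families of a matrix family along the real segment: the hypothesis shape PART 7 consumes, produced from the Loewner data. [folklore] -/
theorem entry_rate_of_loewner
    (hmono : ∀ k (s : ℝ), 0 ≤ s → s ≤ s₁ → (F (k + 1) (s : ℂ) - F k (s : ℂ)).PosSemidef)
    (hdiag : ∀ k (s : ℝ), 0 ≤ s → s ≤ s₁ → ∀ a, ((F (k + 1) (s : ℂ) - F k (s : ℂ)) a a).re ≤ c * θ ^ k) (a b : n) :
    ∀ k (s : ℝ), 0 ≤ s → s ≤ s₁ → ‖F (k + 1) (s : ℂ) a b - F k (s : ℂ) a b‖ ≤ c * θ ^ k := fun k s hs0 hs1 => by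
  simpa only [Matrix.sub_apply] using norm_apply_le_of_diag_le (hmono k s hs0 hs1) (hdiag k s hs0 hs1) a b

/-- **`deriv_entry_step_rateω` — LOEWNER DATA ON THE REAL SEGMENT + HOLOMORPHY WITH ONE BOUND ⟹ THE DERIVATIVE ROWS INHERIT THE RATE**
[our proof, PART 7 BY NAME]: `z ↦ (F k z)_{ab}` holomorphic on `ball 0 ρ` with `‖(F k z)_{ab}‖ ≤ B` (all `k, a, b`); at every real `s ∈ [0, s₁]`
(`0 < s₁`, `s₁·cosh 1 < ρ`) the step `F (k+1) s − F k s` is PSD with diagonal `re (·)_{aa} ≤ c·θ^k` (`0 < c`, `0 < θ`): for every `r ∈ ]0,1]`,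
`k`, `a`, `b`, `‖∂_z (F (k+1))_{ab}(0) − ∂_z (F k)_{ab}(0)‖ ≤ 25·(2B)^r∕(s₁r²) · c^{1−r} · (θ^{1−r})^k`. -/
theorem deriv_entry_step_rateω (hs₁ : 0 < s₁) (hs₁ρ : s₁ * Real.cosh 1 < ρ)
    (hF : ∀ k a b, DifferentiableOn ℂ (fun z => F k z a b) (ball (0 : ℂ) ρ))
    (hB : ∀ k a b, ∀ z ∈ ball (0 : ℂ) ρ, ‖F k z a b‖ ≤ B)
    (hmono : ∀ k (s : ℝ), 0 ≤ s → s ≤ s₁ → (F (k + 1) (s : ℂ) - F k (s : ℂ)).PosSemidef)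
    (hdiag : ∀ k (s : ℝ), 0 ≤ s → s ≤ s₁ → ∀ a, ((F (k + 1) (s : ℂ) - F k (s : ℂ)) a a).re ≤ c * θ ^ k)
    (hc : 0 < c) (hθ : 0 < θ) {r : ℝ} (hr : 0 < r) (hr1 : r ≤ 1) (k : ℕ) (a b : n) :
    ‖deriv (fun z => F (k + 1) z a b) 0 - deriv (fun z => F k z a b) 0‖ ≤
      25 * (2 * B) ^ r / (s₁ * r ^ 2) * c ^ (1 - r) * (θ ^ (1 - r)) ^ k :=
  deriv_step_rateω (F := fun k z => F k z a b) hs₁ hs₁ρ (fun k => hF k a b) (fun k => hB k a b)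
    (entry_rate_of_loewner hmono hdiag a b) hc hθ hr hr1 k

/-- **`exists_deriv_entry_geometricRate` — THE ∃θ-CURRENCY END, ONE PAIR `(c′, θ′)` FOR ALL ENTRIES** [our proof]: under the hypotheses of
`deriv_entry_step_rateω` with `θ < 1`: `∃ c′ θ′, 0 ≤ c′ ∧ 0 ≤ θ′ ∧ θ′ < 1 ∧ ∀ k a b, ‖∂_z (F (k+1))_{ab}(0) − ∂_z (F k)_{ab}(0)‖ ≤ c′·θ′^k`
(witness `θ′ = θ^{1∕2}`). -/
theorem exists_deriv_entry_geometricRate (hs₁ : 0 < s₁) (hs₁ρ : s₁ * Real.cosh 1 < ρ)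
    (hF : ∀ k a b, DifferentiableOn ℂ (fun z => F k z a b) (ball (0 : ℂ) ρ))
    (hB : ∀ k a b, ∀ z ∈ ball (0 : ℂ) ρ, ‖F k z a b‖ ≤ B)
    (hmono : ∀ k (s : ℝ), 0 ≤ s → s ≤ s₁ → (F (k + 1) (s : ℂ) - F k (s : ℂ)).PosSemidef)
    (hdiag : ∀ k (s : ℝ), 0 ≤ s → s ≤ s₁ → ∀ a, ((F (k + 1) (s : ℂ) - F k (s : ℂ)) a a).re ≤ c * θ ^ k)
    (hc : 0 < c) (hθ : 0 < θ) (hθ1 : θ < 1) [Nonempty n] :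
    ∃ c' θ' : ℝ, 0 ≤ c' ∧ 0 ≤ θ' ∧ θ' < 1 ∧
      ∀ k a b, ‖deriv (fun z => F (k + 1) z a b) 0 - deriv (fun z => F k z a b) 0‖ ≤ c' * θ' ^ k := by
  have hρ : 0 < ρ := rho_pos hs₁ hs₁ρ
  obtain ⟨a₀⟩ := ‹Nonempty n›
  have hB0 : 0 ≤ B := (norm_nonneg _).trans (hB 0 a₀ a₀ 0 (mem_ball_self hρ))
  refine ⟨25 * (2 * B) ^ (1 / 2 : ℝ) / (s₁ * (1 / 2 : ℝ) ^ 2) * c ^ (1 - 1 / 2 : ℝ), θ ^ (1 - 1 / 2 : ℝ), ?_, ?_, ?_,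
    fun k a b => ?_⟩
  · have : 0 ≤ (2 * B) ^ (1 / 2 : ℝ) := Real.rpow_nonneg (by linarith) _
    have : 0 ≤ c ^ (1 - 1 / 2 : ℝ) := Real.rpow_nonneg hc.le _
    positivity
  · exact Real.rpow_nonneg hθ.le _
  · exact Real.rpow_lt_one hθ.le hθ1 (by norm_num)
  · exact deriv_entry_step_rateω hs₁ hs₁ρ hF hB hmono hdiag hc hθ (by norm_num) (by norm_num) k a b

/-- **`deriv₂_entry_step_rateω` — SECOND-ORDER ROWS** [our proof, PART 7 `deriv₂_step_rateω` BY NAME]: under the hypotheses of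
`deriv_entry_step_rateω` with `0 < B`, for every `r ∈ ]0,1]`, `k`, `a`, `b`:
`‖∂_z²(F (k+1))_{ab}(0) − ∂_z²(F k)_{ab}(0)‖ ≤ 25·(A^{1−r}·B″^r)∕((s₁∕2)r²) · ((θ^{1−r})^{1−r})^k`,
`A = 25·c^{1−r}·(2B)^r∕((s₁∕2)r²)`, `B″ = 2·(2B)∕(ρ − s₁·cosh 1)`. -/
theorem deriv₂_entry_step_rateω (hs₁ : 0 < s₁) (hs₁ρ : s₁ * Real.cosh 1 < ρ)
    (hF : ∀ k a b, DifferentiableOn ℂ (fun z => F k z a b) (ball (0 : ℂ) ρ))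
    (hB : ∀ k a b, ∀ z ∈ ball (0 : ℂ) ρ, ‖F k z a b‖ ≤ B) (hB0 : 0 < B)
    (hmono : ∀ k (s : ℝ), 0 ≤ s → s ≤ s₁ → (F (k + 1) (s : ℂ) - F k (s : ℂ)).PosSemidef)
    (hdiag : ∀ k (s : ℝ), 0 ≤ s → s ≤ s₁ → ∀ a, ((F (k + 1) (s : ℂ) - F k (s : ℂ)) a a).re ≤ c * θ ^ k)
    (hc : 0 < c) (hθ : 0 < θ) {r : ℝ} (hr : 0 < r) (hr1 : r ≤ 1) (k : ℕ) (a b : n) :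
    ‖deriv (deriv fun z => F (k + 1) z a b) 0 - deriv (deriv fun z => F k z a b) 0‖ ≤
      25 * ((25 * c ^ (1 - r) * (2 * B) ^ r / (s₁ / 2 * r ^ 2)) ^ (1 - r)
        * (2 * (2 * B) / (ρ - s₁ * Real.cosh 1)) ^ r) / (s₁ / 2 * r ^ 2) * ((θ ^ (1 - r)) ^ (1 - r)) ^ k :=
  deriv₂_step_rateω (F := fun k z => F k z a b) hs₁ hs₁ρ (fun k => hF k a b) (fun k => hB k a b) hB0
    (entry_rate_of_loewner hmono hdiag a b) hc hθ hr hr1 k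

end Join

/-! ## §3 The Galerkin source of the diagonal rate: ONE trial field per unit source; the consistency defect of the prolongated minimiser -/

section Galerkin

variable {m n : Type*} [Fintype m] [Fintype n] [DecidableEq m] [DecidableEq n]

/-- [folklore] the quadratic form at a unit vector is the diagonal entry: `⟨e_y, E e_y⟩ = E_{yy}`. -/
theorem star_single_dotProduct_mulVec_single (E : Matrix m m ℂ) (y : m) :
    star (Pi.single y (1 : ℂ)) ⬝ᵥ (E *ᵥ Pi.single y 1) = E y y := by
  have hs : star (Pi.single y (1 : ℂ) : m → ℂ) = Pi.single y 1 := by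
    ext i; by_cases h : i = y <;> simp [h, Pi.single_eq_of_ne]
  rw [hs, single_dotProduct, one_mul, Matrix.mulVec_single_one, Matrix.col_apply]

omit [DecidableEq m] [DecidableEq n] in
/-- [folklore] moving a rectangular matrix across the sesquilinear pairing: `⟨Mv, w⟩ = ⟨v, Mᴴw⟩`. -/
theorem star_mulVec_dotProduct' (M : Matrix n m ℂ) (v : m → ℂ) (w : n → ℂ) :
    star (M *ᵥ v) ⬝ᵥ w = star v ⬝ᵥ (Mᴴ *ᵥ w) := by
  rw [star_mulVec, ← dotProduct_mulVec]

omit [DecidableEq m] [DecidableEq n] in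
/-- [folklore] the energy of `Mv` in the form `H` is the form `MᴴHM` at `v`: `⟨Mv, H(Mv)⟩ = ⟨v, (MᴴHM)v⟩`. -/
theorem energy_conj (H : Matrix n n ℂ) (M : Matrix n m ℂ) (v : m → ℂ) :
    star (M *ᵥ v) ⬝ᵥ (H *ᵥ (M *ᵥ v)) = star v ⬝ᵥ ((Mᴴ * H * M) *ᵥ v) := by
  rw [star_mulVec_dotProduct', Matrix.mulVec_mulVec, Matrix.mulVec_mulVec, Matrix.mul_assoc]

variable {H : Matrix n n ℂ} {Q : Matrix m n ℂ}

/-- **THE EFFECTIVE FORM IS BELOW THE ENERGY OF EVERY ADMISSIBLE TRIAL FIELD** (the variational definition of `Δ_eff`, road P4's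
`form_sub_effForm_conj` read at one vector): `0 < H`, `Q` with independent rows, `Qu = e_y` ⟹ `re (Δ_eff(H,Q))_{yy} ≤ re ⟨u, Hu⟩`. [folklore] -/
theorem re_effForm_apply_le_trial (hH : H.PosDef) (hQ : Function.Injective Q.vecMul) {u : n → ℂ} {y : m}
    (hu : Q *ᵥ u = Pi.single y 1) : (effForm H Q y y).re ≤ (star u ⬝ᵥ (H *ᵥ u)).re := by
  have h0 := (form_sub_effForm_conj hH hQ).dotProduct_mulVec_nonneg u
  have e : star u ⬝ᵥ ((H - Qᴴ * effForm H Q * Q) *ᵥ u) = star u ⬝ᵥ (H *ᵥ u) - effForm H Q y y := by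
    rw [Matrix.sub_mulVec, dotProduct_sub, ← energy_conj (effForm H Q) Q u, hu, star_single_dotProduct_mulVec_single]
  rw [e] at h0
  have := (Complex.le_def.mp h0).1
  simp only [Complex.zero_re, Complex.sub_re] at this
  linarith

/-- **… WITH EQUALITY AT THE MINIMISER** (B5 (1.65) in matrix form, p3's `minimiser_energy` read at `e_y`; locator only):
`re (Δ_eff(H,Q))_{yy} = re ⟨ℋe_y, H ℋe_y⟩`, `ℋ = minimiser H Q`. [folklore] -/
theorem re_effForm_apply_eq_minimiser (hH : H.PosDef) (hQ : Function.Injective Q.vecMul) (y : m) :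
    (effForm H Q y y).re =
      (star (minimiser H Q *ᵥ Pi.single y 1) ⬝ᵥ (H *ᵥ (minimiser H Q *ᵥ Pi.single y 1))).re := by
  rw [energy_conj, minimiser_energy hH.isUnit hH.isHermitian (isUnit_pivot_of_posDef hH hQ), star_single_dotProduct_mulVec_single]

/-- the minimiser of the unit source `e_y` is admissible: `Q(ℋe_y) = e_y`. [folklore] -/
theorem constraint_mulVec_minimiser_single (hH : H.PosDef) (hQ : Function.Injective Q.vecMul) (y : m) :
    Q *ᵥ (minimiser H Q *ᵥ Pi.single y 1) = Pi.single y 1 := by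
  rw [Matrix.mulVec_mulVec, constraint_mul_minimiser (isUnit_pivot_of_posDef hH hQ), Matrix.one_mulVec]

variable {n' : Type*} [Fintype n'] [DecidableEq n'] {H' : Matrix n' n' ℂ} {Q' : Matrix m n' ℂ} {P : Matrix n' n ℂ}

/-- **THE PROLONGATED MINIMISER IS AN ADMISSIBLE TRIAL FIELD ONE LEVEL UP, AND ITS ENERGY EXCESS IS THE CONSISTENCY DEFECT**: for an
averaging-compatible prolongation `P` (`Q′P = Q`) and `m_y := ℋe_y` (the level-`H` minimiser of the unit source), `u := P m_y` satisfies `Q′u = e_y`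
and `re (Δ_eff(H′,Q′))_{yy} − re (Δ_eff(H,Q))_{yy} ≤ re ⟨m_y, (PᴴH′P − H) m_y⟩`. [folklore] -/
theorem re_effForm_step_diag_le_cons (hH : H.PosDef) (hQ : Function.Injective Q.vecMul) (hH' : H'.PosDef)
    (hQ' : Function.Injective Q'.vecMul) (hPQ : Q' * P = Q) (y : m) :
    (effForm H' Q' y y).re - (effForm H Q y y).re ≤
      (star (minimiser H Q *ᵥ Pi.single y 1) ⬝ᵥ
        ((Pᴴ * H' * P - H) *ᵥ (minimiser H Q *ᵥ Pi.single y 1))).re := by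
  set my : n → ℂ := minimiser H Q *ᵥ Pi.single y 1 with hmy
  have hadm : Q' *ᵥ (P *ᵥ my) = Pi.single y 1 := by
    rw [Matrix.mulVec_mulVec, hPQ, hmy, constraint_mulVec_minimiser_single hH hQ]
  have h1 := re_effForm_apply_le_trial hH' hQ' hadm
  have h2 := re_effForm_apply_eq_minimiser hH hQ y
  rw [energy_conj] at h1
  rw [Matrix.sub_mulVec, dotProduct_sub, Complex.sub_re, ← hmy] at *
  linarith

end Galerkin

/-! ## §3′ The END in tower form: (STAB) + (CONS) ⟹ the entry one-step rate of the composite effective forms -/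

section Tower

variable {c : Type*} [Fintype c] [DecidableEq c]
variable {ι : ℕ → Type*} [∀ j, Fintype (ι j)] [∀ j, DecidableEq (ι j)]
variable {H : ∀ j, Matrix (ι j) (ι j) ℂ} {Qf : ∀ j, Matrix (ι j) (ι (j + 1)) ℂ} {Qc : ∀ j, Matrix c (ι j) ℂ}
variable {P : ∀ j, Matrix (ι (j + 1)) (ι j) ℂ} {cst θ : ℝ}

/-- **`effForm_entry_step_rate_of_stab_of_cons` — THE WITH-BACKGROUND S1 SHAPE FOR EFFECTIVE FORMS, REDUCED TO TWO FAMILIES OF QUADRATIC-FORM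
INEQUALITIES** [our proof]: a tower of positive definite fine forms `H j`, one-step averagings `Qf j` (level `j+1 → j`) and composite averagings
`Qc j` to the fixed unit index `c` with independent rows and `Qc (j+1) = Qc j · Qf j`, prolongations `P j` (level `j → j+1`) with `Qc (j+1) · P j = Qc j`;
(STAB_j) `(Qf j)ᴴ (H j) (Qf j) ≤ H (j+1)` (one averaging step does not increase the energy) and (CONS_{j,y})
`re ⟨ℋ_j e_y, ((P j)ᴴ H (j+1) (P j) − H j) ℋ_j e_y⟩ ≤ cst·θ^j` (the prolongation-consistency defect of the unit-source minimiser) for all `j`, `y`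
⟹ for the composite effective forms `E j := Δ_eff(H j, Qc j)`: `‖(E (j+1))_{ab} − (E j)_{ab}‖ ≤ cst·θ^j` for ALL `j`, `a`, `b`. -/
theorem effForm_entry_step_rate_of_stab_of_cons (hH : ∀ j, (H j).PosDef) (hQf : ∀ j, Function.Injective (Qf j).vecMul)
    (hQc : ∀ j, Function.Injective (Qc j).vecMul) (hcomp : ∀ j, Qc (j + 1) = Qc j * Qf j) (hPQ : ∀ j, Qc (j + 1) * P j = Qc j)
    (hstab : ∀ j, (H (j + 1) - (Qf j)ᴴ * H j * Qf j).PosSemidef)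
    (hcons : ∀ j (y : c),
      (star (minimiser (H j) (Qc j) *ᵥ Pi.single y 1) ⬝ᵥ
        (((P j)ᴴ * H (j + 1) * P j - H j) *ᵥ (minimiser (H j) (Qc j) *ᵥ Pi.single y 1))).re ≤ cst * θ ^ j) :
    ∀ j (a b : c), ‖effForm (H (j + 1)) (Qc (j + 1)) a b - effForm (H j) (Qc j) a b‖ ≤ cst * θ ^ j := by
  have hstep : ∀ j, 0 ≤ j → (effForm (H (j + 1)) (Qc (j + 1)) - effForm (H j) (Qc j)).PosSemidef :=
    effForm_chain_step_of_stab (k₀ := 0) hH hQf hQc hcomp (fun j _ => hstab j)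
  have hdiag : ∀ j, 0 ≤ j → ∀ y, ((effForm (H (j + 1)) (Qc (j + 1)) - effForm (H j) (Qc j)) y y).re ≤ cst * θ ^ j :=
    fun j _ y => by
      rw [Matrix.sub_apply, Complex.sub_re]
      exact (re_effForm_step_diag_le_cons (hH j) (hQc j) (hH (j + 1)) (hQc (j + 1)) (hPQ j) y).trans (hcons j y)
  intro j a b
  exact norm_step_apply_le_of_diag (P := fun j => effForm (H j) (Qc j)) hstep hdiag j (Nat.zero_le j) a b

/-- **THE TRIAL-FIELD FORM** (any admissible trial fields, not necessarily prolongated minimisers): (STAB_j) ∀ j + for every `j, y` a field `u` with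
`Qc (j+1) u = e_y` and `re ⟨u, H (j+1) u⟩ ≤ re (E j)_{yy} + cst·θ^j` ⟹ the same entry rate. [our proof] -/
theorem effForm_entry_step_rate_of_stab_of_trial (hH : ∀ j, (H j).PosDef) (hQf : ∀ j, Function.Injective (Qf j).vecMul)
    (hQc : ∀ j, Function.Injective (Qc j).vecMul) (hcomp : ∀ j, Qc (j + 1) = Qc j * Qf j)
    (hstab : ∀ j, (H (j + 1) - (Qf j)ᴴ * H j * Qf j).PosSemidef)
    (htrial : ∀ j (y : c), ∃ u : ι (j + 1) → ℂ, Qc (j + 1) *ᵥ u = Pi.single y 1 ∧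
      (star u ⬝ᵥ (H (j + 1) *ᵥ u)).re ≤ (effForm (H j) (Qc j) y y).re + cst * θ ^ j) :
    ∀ j (a b : c), ‖effForm (H (j + 1)) (Qc (j + 1)) a b - effForm (H j) (Qc j) a b‖ ≤ cst * θ ^ j := by
  have hstep : ∀ j, 0 ≤ j → (effForm (H (j + 1)) (Qc (j + 1)) - effForm (H j) (Qc j)).PosSemidef :=
    effForm_chain_step_of_stab (k₀ := 0) hH hQf hQc hcomp (fun j _ => hstab j)
  have hdiag : ∀ j, 0 ≤ j → ∀ y, ((effForm (H (j + 1)) (Qc (j + 1)) - effForm (H j) (Qc j)) y y).re ≤ cst * θ ^ j :=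
    fun j _ y => by
      obtain ⟨u, hu, hle⟩ := htrial j y
      rw [Matrix.sub_apply, Complex.sub_re]
      linarith [re_effForm_apply_le_trial (hH (j + 1)) (hQc (j + 1)) hu]
  intro j a b
  exact norm_step_apply_le_of_diag (P := fun j => effForm (H j) (Qc j)) hstep hdiag j (Nat.zero_le j) a b

end Tower

/-! ## §4 THE END of this PART: (STAB) + (CONS) along the real background segment + S2 (holomorphy, one bound) ⟹ the derivative rows of the
effective forms at the base point inherit the rate — no fibre, no translation invariance anywhere in the hypotheses -/

section TowerJoin

variable {c : Type*} [Fintype c] [DecidableEq c]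
variable {ι : ℕ → Type*} [∀ j, Fintype (ι j)] [∀ j, DecidableEq (ι j)]
variable {H : ∀ j, ℝ → Matrix (ι j) (ι j) ℂ} {Qf : ∀ j, ℝ → Matrix (ι j) (ι (j + 1)) ℂ} {Qc : ∀ j, ℝ → Matrix c (ι j) ℂ}
variable {P : ∀ j, ℝ → Matrix (ι (j + 1)) (ι j) ℂ} {F : ℕ → ℂ → Matrix c c ℂ} {ρ s₁ B cst θ : ℝ}

/-- **THE LOEWNER DATA OF §2 FROM (STAB) + (CONS) ALONG THE SEGMENT** [our proof]: a one-parameter family of towers (`s ∈ [0, s₁]` = the real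
background segment; fine forms `H j s`, one-step averagings `Qf j s`, composite averagings `Qc j s` with `Qc (j+1) s = Qc j s · Qf j s`,
prolongations `P j s` with `Qc (j+1) s · P j s = Qc j s` — ALL allowed to depend on the background) and a matrix family `F j : ℂ → Matrix c c ℂ`
that AGREES with the composite effective forms on the segment (`F j s = Δ_eff(H j s, Qc j s)`, the consumer's identification); (STAB_j(s)) and
(CONS_{j,y}(s)) with constant `cst·θ^j` uniformly in `s` ⟹ on the segment the steps `F (j+1) s − F j s` are PSD with diagonal `≤ cst·θ^j`. -/
theorem loewner_data_of_stab_of_cons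
    (hFeff : ∀ j (s : ℝ), 0 ≤ s → s ≤ s₁ → F j (s : ℂ) = effForm (H j s) (Qc j s))
    (hH : ∀ j (s : ℝ), 0 ≤ s → s ≤ s₁ → (H j s).PosDef)
    (hQf : ∀ j (s : ℝ), 0 ≤ s → s ≤ s₁ → Function.Injective (Qf j s).vecMul)
    (hQc : ∀ j (s : ℝ), 0 ≤ s → s ≤ s₁ → Function.Injective (Qc j s).vecMul)
    (hcomp : ∀ j (s : ℝ), 0 ≤ s → s ≤ s₁ → Qc (j + 1) s = Qc j s * Qf j s)
    (hPQ : ∀ j (s : ℝ), 0 ≤ s → s ≤ s₁ → Qc (j + 1) s * P j s = Qc j s)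
    (hstab : ∀ j (s : ℝ), 0 ≤ s → s ≤ s₁ → (H (j + 1) s - (Qf j s)ᴴ * H j s * Qf j s).PosSemidef)
    (hcons : ∀ j (s : ℝ), 0 ≤ s → s ≤ s₁ → ∀ y : c,
      (star (minimiser (H j s) (Qc j s) *ᵥ Pi.single y 1) ⬝ᵥ
        (((P j s)ᴴ * H (j + 1) s * P j s - H j s) *ᵥ (minimiser (H j s) (Qc j s) *ᵥ Pi.single y 1))).re ≤ cst * θ ^ j) :
    (∀ k (s : ℝ), 0 ≤ s → s ≤ s₁ → (F (k + 1) (s : ℂ) - F k (s : ℂ)).PosSemidef) ∧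
      ∀ k (s : ℝ), 0 ≤ s → s ≤ s₁ → ∀ a, ((F (k + 1) (s : ℂ) - F k (s : ℂ)) a a).re ≤ cst * θ ^ k := by
  refine ⟨fun k s hs0 hs1 => ?_, fun k s hs0 hs1 a => ?_⟩
  · rw [hFeff (k + 1) s hs0 hs1, hFeff k s hs0 hs1]
    exact effForm_chain_step_of_stab (k₀ := 0) (H := fun j => H j s) (Qf := fun j => Qf j s) (Qc := fun j => Qc j s)
      (fun j => hH j s hs0 hs1) (fun j => hQf j s hs0 hs1) (fun j => hQc j s hs0 hs1) (fun j => hcomp j s hs0 hs1)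
      (fun j _ => hstab j s hs0 hs1) k (Nat.zero_le k)
  · rw [hFeff (k + 1) s hs0 hs1, hFeff k s hs0 hs1, Matrix.sub_apply, Complex.sub_re]
    exact (re_effForm_step_diag_le_cons (hH k s hs0 hs1) (hQc k s hs0 hs1) (hH (k + 1) s hs0 hs1) (hQc (k + 1) s hs0 hs1)
      (hPQ k s hs0 hs1) a).trans (hcons k s hs0 hs1 a)

/-- **`deriv_effForm_entry_step_rateω` — THE END: (STAB) + (CONS) ON THE REAL BACKGROUND SEGMENT + S2 ⟹ THE u-DERIVATIVE ROWS OF THE EFFECTIVE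
FORMS INHERIT THE RATE** [our proof]: under the hypotheses of `loewner_data_of_stab_of_cons` (`0 < cst`, `0 < θ`) and S2 — each entry `z ↦ (F j z)_{ab}`
holomorphic on `ball 0 ρ` with `‖(F j z)_{ab}‖ ≤ B`, `0 < s₁`, `s₁·cosh 1 < ρ` — for every `r ∈ ]0,1]`, `k`, `a`, `b`:
`‖∂_z(F (k+1))_{ab}(0) − ∂_z(F k)_{ab}(0)‖ ≤ 25·(2B)^r∕(s₁r²)·cst^{1−r}·(θ^{1−r})^k`.  Nothing here is a fibre or a symbol: (STAB) and (CONS) are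
quadratic-form inequalities about the fine forms, the averagings and the prolongations at each REAL background of the segment. -/
theorem deriv_effForm_entry_step_rateω (hs₁ : 0 < s₁) (hs₁ρ : s₁ * Real.cosh 1 < ρ)
    (hF : ∀ k a b, DifferentiableOn ℂ (fun z => F k z a b) (ball (0 : ℂ) ρ))
    (hB : ∀ k a b, ∀ z ∈ ball (0 : ℂ) ρ, ‖F k z a b‖ ≤ B)
    (hFeff : ∀ j (s : ℝ), 0 ≤ s → s ≤ s₁ → F j (s : ℂ) = effForm (H j s) (Qc j s))
    (hH : ∀ j (s : ℝ), 0 ≤ s → s ≤ s₁ → (H j s).PosDef)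
    (hQf : ∀ j (s : ℝ), 0 ≤ s → s ≤ s₁ → Function.Injective (Qf j s).vecMul)
    (hQc : ∀ j (s : ℝ), 0 ≤ s → s ≤ s₁ → Function.Injective (Qc j s).vecMul)
    (hcomp : ∀ j (s : ℝ), 0 ≤ s → s ≤ s₁ → Qc (j + 1) s = Qc j s * Qf j s)
    (hPQ : ∀ j (s : ℝ), 0 ≤ s → s ≤ s₁ → Qc (j + 1) s * P j s = Qc j s)
    (hstab : ∀ j (s : ℝ), 0 ≤ s → s ≤ s₁ → (H (j + 1) s - (Qf j s)ᴴ * H j s * Qf j s).PosSemidef)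
    (hcons : ∀ j (s : ℝ), 0 ≤ s → s ≤ s₁ → ∀ y : c,
      (star (minimiser (H j s) (Qc j s) *ᵥ Pi.single y 1) ⬝ᵥ
        (((P j s)ᴴ * H (j + 1) s * P j s - H j s) *ᵥ (minimiser (H j s) (Qc j s) *ᵥ Pi.single y 1))).re ≤ cst * θ ^ j)
    (hc : 0 < cst) (hθ : 0 < θ) {r : ℝ} (hr : 0 < r) (hr1 : r ≤ 1) (k : ℕ) (a b : c) :
    ‖deriv (fun z => F (k + 1) z a b) 0 - deriv (fun z => F k z a b) 0‖ ≤
      25 * (2 * B) ^ r / (s₁ * r ^ 2) * cst ^ (1 - r) * (θ ^ (1 - r)) ^ k := by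
  obtain ⟨hmono, hdiag⟩ := loewner_data_of_stab_of_cons hFeff hH hQf hQc hcomp hPQ hstab hcons
  exact deriv_entry_step_rateω hs₁ hs₁ρ hF hB hmono hdiag hc hθ hr hr1 k a b

/-- **… AND IN THE ∃θ-CURRENCY** (one `(c′, θ′ < 1)` for all entries; witness `θ′ = θ^{1∕2}`). [our proof] -/
theorem exists_deriv_effForm_entry_geometricRate [Nonempty c] (hs₁ : 0 < s₁) (hs₁ρ : s₁ * Real.cosh 1 < ρ)
    (hF : ∀ k a b, DifferentiableOn ℂ (fun z => F k z a b) (ball (0 : ℂ) ρ))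
    (hB : ∀ k a b, ∀ z ∈ ball (0 : ℂ) ρ, ‖F k z a b‖ ≤ B)
    (hFeff : ∀ j (s : ℝ), 0 ≤ s → s ≤ s₁ → F j (s : ℂ) = effForm (H j s) (Qc j s))
    (hH : ∀ j (s : ℝ), 0 ≤ s → s ≤ s₁ → (H j s).PosDef)
    (hQf : ∀ j (s : ℝ), 0 ≤ s → s ≤ s₁ → Function.Injective (Qf j s).vecMul)
    (hQc : ∀ j (s : ℝ), 0 ≤ s → s ≤ s₁ → Function.Injective (Qc j s).vecMul)
    (hcomp : ∀ j (s : ℝ), 0 ≤ s → s ≤ s₁ → Qc (j + 1) s = Qc j s * Qf j s)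
    (hPQ : ∀ j (s : ℝ), 0 ≤ s → s ≤ s₁ → Qc (j + 1) s * P j s = Qc j s)
    (hstab : ∀ j (s : ℝ), 0 ≤ s → s ≤ s₁ → (H (j + 1) s - (Qf j s)ᴴ * H j s * Qf j s).PosSemidef)
    (hcons : ∀ j (s : ℝ), 0 ≤ s → s ≤ s₁ → ∀ y : c,
      (star (minimiser (H j s) (Qc j s) *ᵥ Pi.single y 1) ⬝ᵥ
        (((P j s)ᴴ * H (j + 1) s * P j s - H j s) *ᵥ (minimiser (H j s) (Qc j s) *ᵥ Pi.single y 1))).re ≤ cst * θ ^ j)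
    (hc : 0 < cst) (hθ : 0 < θ) (hθ1 : θ < 1) :
    ∃ c' θ' : ℝ, 0 ≤ c' ∧ 0 ≤ θ' ∧ θ' < 1 ∧
      ∀ k a b, ‖deriv (fun z => F (k + 1) z a b) 0 - deriv (fun z => F k z a b) 0‖ ≤ c' * θ' ^ k := by
  obtain ⟨hmono, hdiag⟩ := loewner_data_of_stab_of_cons hFeff hH hQf hQc hcomp hPQ hstab hcons
  exact exists_deriv_entry_geometricRate hs₁ hs₁ρ hF hB hmono hdiag hc hθ hθ1

end TowerJoin

end Summit.QuantumFields.BalabanUV.Beta.GAN24.DerivativeRateTransferLoewner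

end
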